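import Mathlib
import Summits.Ventures.HodgeRepro.Tier4.Target
import Summits.Ventures.HodgeRepro.Tier4.Line3.KMDatum
import Summits.Ventures.HodgeRepro.Tier4.Line3.KMDatumS
import Summits.Ventures.HodgeRepro.Tier4.Line3.Defs
import Summits.Ventures.HodgeRepro.Tier4.Line3.DatumOrthVanishing
import Summits.Ventures.HodgeRepro.Tier4.Line3.Transvection

/-!
# Tier4/Line3/KMKernelForm — the Kudla–Millson quadruple kernel at a symmetric centre in closed form

Blind re-derivation cell `pub-hodge-repro`, Tier 4 «PROVE THE STEP», LINE L3, seat t4-x2 (g4, reserve wall-breaker),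
cut C-L3-HKRAY: the explicit `P` of bus S14325 (F6)/(F8) as kernel objects, for the analysis seat.

With `f_j := (lift3 z)^* J y_j`, `g := 1 − |z|²`, `E_j := e^{−π maj(y_j, z)}` and `y'_j := (y_j 0, y_j 1)`:

  `wedge (kmDatum y_0 z) (kmDatum y_1 z) = (f_0 f_1 / g²) · W(z) · E_0 E_1`,
  `W(z) := wedge (conj y'_0 + (conj f_0 / g) conj z) (conj y'_1 + (conj f_1 / g) conj z)`

(`wedge_kmDatum`), so at a symmetric centre the KM kernel is `|f_0 f_1|² g^{−4} |W|² e^{−2π(maj_0 + maj_1)}`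
(`kmKernel_symm`): it vanishes on the two complex lines `{f_j = 0}` and nowhere else near their common point `z*`,
where `W(z*) = conj (det [y'_0 | y'_1])` (`W_at_jOrth`).

Nothing here says anything about the status of the Hodge conjecture for CM abelian varieties, which is NOT proved
(HC_CM is NOT proved by anyone in this repository).
-/

set_option autoImplicit false

noncomputable section

namespace Summit.Ventures.HodgeRepro.Tier4.Line3

open Summit.Ventures.HodgeRepro.Tier4
open Matrix
open scoped ComplexConjugate

/-- The conjugate-linear part of the KM datum: `W_j(z) := conj y'_j + (conj f_j / g) conj z` as a `2`-vector. -/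
def kmLin (y : Fin 3 → ℂ) (z : Fin 2 → ℂ) : Fin 2 → ℂ :=
  fun l => conj (y (Fin.castSucc l)) + conj (star (lift3 z) ⬝ᵥ (J *ᵥ y)) / ((1 - nsq z : ℝ) : ℂ) * conj (z l)

/-- `kmDatum y z = −(f/g) · kmLin y z · e^{−π maj}`. -/
theorem kmDatum_eq_kmLin (y : Fin 3 → ℂ) (z : Fin 2 → ℂ) (l : Fin 2) :
    kmDatum y z l = -((star (lift3 z) ⬝ᵥ (J *ᵥ y)) / ((1 - nsq z : ℝ) : ℂ)) * kmLin y z l *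
      ((Real.exp (-Real.pi * maj y z) : ℝ) : ℂ) := by
  unfold kmDatum kmLin
  ring

/-- **THE WEDGE OF TWO KM DATA**: `(f_0 f_1 / g²) · wedge (kmLin y_0 z) (kmLin y_1 z) · E_0 E_1`. -/
theorem wedge_kmDatum (y0 y1 : Fin 3 → ℂ) (z : Fin 2 → ℂ) :
    wedge (kmDatum y0 z) (kmDatum y1 z) =
      ((star (lift3 z) ⬝ᵥ (J *ᵥ y0)) * (star (lift3 z) ⬝ᵥ (J *ᵥ y1)) / ((1 - nsq z : ℝ) : ℂ) ^ 2) *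
        wedge (kmLin y0 z) (kmLin y1 z) *
        (((Real.exp (-Real.pi * maj y0 z) : ℝ) : ℂ) * ((Real.exp (-Real.pi * maj y1 z) : ℝ) : ℂ)) := by
  unfold wedge
  rw [kmDatum_eq_kmLin, kmDatum_eq_kmLin, kmDatum_eq_kmLin, kmDatum_eq_kmLin]
  ring

namespace T4Data

/-- **THE KM KERNEL AT A SYMMETRIC CENTRE** is `|f_0 f_1|² g^{−4} |W|² e^{−2π(maj_0+maj_1)}`. -/
theorem kmKernel_symm (X : T4Data) (xm : X.Tuple) (h02 : xm 2 = xm 0) (h13 : xm 3 = xm 1) (z : Fin 2 → ℂ) :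
    X.kmKernel xm z =
      ((Complex.normSq ((star (lift3 z) ⬝ᵥ (J *ᵥ X.ballCoord (xm 0))) * (star (lift3 z) ⬝ᵥ (J *ᵥ X.ballCoord (xm 1)))) /
          (1 - nsq z) ^ 4 *
        Complex.normSq (wedge (kmLin (X.ballCoord (xm 0)) z) (kmLin (X.ballCoord (xm 1)) z)) *
        Real.exp (-(2 * Real.pi * (maj (X.ballCoord (xm 0)) z + maj (X.ballCoord (xm 1)) z))) : ℝ) : ℂ) := by
  unfold kmKernel
  rw [h02, h13, wedge_kmDatum, Complex.mul_conj]
  congr 1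
  simp only [map_mul, map_div₀, map_pow, Complex.normSq_ofReal]
  have hE : ∀ a b : ℝ, Real.exp a * Real.exp a * (Real.exp b * Real.exp b) = Real.exp (2 * (a + b)) := by
    intro a b
    rw [← Real.exp_add, ← Real.exp_add, ← Real.exp_add]
    ring_nf
  rw [hE]
  have h2 : 2 * (-Real.pi * maj (X.ballCoord (xm 0)) z + -Real.pi * maj (X.ballCoord (xm 1)) z) =
      -(2 * Real.pi * (maj (X.ballCoord (xm 0)) z + maj (X.ballCoord (xm 1)) z)) := by ring
  rw [h2]
  ring

end T4Data

/-- At a `J`-orthogonal point of both slots (`f_0 = f_1 = 0`), `W = conj (det [y'_0 | y'_1])`. -/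
theorem wedge_kmLin_of_jOrth {y0 y1 : Fin 3 → ℂ} {z : Fin 2 → ℂ} (h0 : star (lift3 z) ⬝ᵥ (J *ᵥ y0) = 0)
    (h1 : star (lift3 z) ⬝ᵥ (J *ᵥ y1) = 0) :
    wedge (kmLin y0 z) (kmLin y1 z) = conj (y0 0 * y1 1 - y0 1 * y1 0) := by
  unfold wedge kmLin
  rw [h0, h1]
  simp

end Summit.Ventures.HodgeRepro.Tier4.Line3

end
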